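import Summits.ResolutionOfSingularities.ResolutionOfSingularities.Theorems.WildSymbol.Negative.LoadBearing

/-!
# `WildSymbol` (stmt-ResolutionOfSingularities-17133) — negative lemmas II: the centre of a witness
# has height ≥ 2 on a normal affine model (Krull–Akizuki calibration)

Support (negative) lemma for crux #2 of route `ResolutionOfSingularities/WildPurity`
(`Summit.ResolutionOfSingularities.ResolutionOfSingularities.Theses.WildPurity.WildSymbol`), filed by the
standing disprover (cdisprove cycle 1; work file `Cruxes/WildSymbol/Disproof.lean`). This file declares NO
definition and NO declaration concludes the route decl positively.

* `not_wildSymbol_of_centre_height_le_one` — the crux with the two extra hypotheses "the affine model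
  `R` is integrally closed in `K`" (as in the route's support item `LocalCandidate`) and "the centre
  `𝔮 = 𝔪_O ∩ R` of `O` on `R` has height `≤ 1`" is FALSE. Proof: `𝔮 ≠ 0` (else `K = Frac R ⊆ O` and
  `O = ⊤`, excluded by `wildSymbol_unr_top`); the explicit local ring `R_𝔮 ⊆ K` is the localisation of
  the Noetherian integrally closed domain `R` at `𝔮`, of Krull dimension `ht 𝔮 ≤ 1` and not a field,
  hence a DVR (`wildSymbol_locSubring_dvr`: `IsLocalization.AtPrime`, `isIntegrallyClosed_of_isLocalization`,
  `IsLocalization.AtPrime.ringKrullDim_eq_height`, `IsDiscreteValuationRing.TFAE` via `IsDedekindDomain`);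
  `O` dominates it, so `O = R_𝔮` (`ValuationSubring.eq_self_or_eq_top_of_le`); then `O` is a DVR
  essentially of finite type (`B := R`) containing `R`, centred inside its own centre — a tested `W`,
  so `α ∈ Unr O`, contradiction.
  MORAL: a witness lives over a point of codimension ≥ 2 of the normalisation; together with
  `LoadBearing.lean` (O non-divisorial, `O ≠ ⊤`, `K/k` transcendental) this is the unconditional part of
  the route's calibration "trdeg ≥ 4, defect place" (the rest needs CossartPiltant2019 + PurityTransfer).

## Sources
* W. Krull / Y. Akizuki (normal one-dimensional Noetherian local domains are DVRs) — Matsumura,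
  *Commutative Ring Theory*, Thm 11.2; here entirely through Mathlib (`IsDiscreteValuationRing.TFAE`).
* O. Zariski, P. Samuel, *Commutative Algebra II*, Ch. VI §5 (valuation rings dominating a DVR).
-/

noncomputable section

set_option linter.dupNamespace false -- mandated namespace of this single-conjunct summit

namespace Summit.ResolutionOfSingularities.ResolutionOfSingularities.Theorems.WildSymbol.Negative

variable {K : Type} [Field K]

/-- An element of `O` that is not a non-unit of `O` has its inverse in `O`. [folklore] -/
theorem wildSymbol_inv_mem_of_not_mem_nonunits (O : ValuationSubring K) {b : K} (hbO : b ∈ O)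
    (hb : b ∉ O.nonunits) : b⁻¹ ∈ O := by
  have h1 : O.valuation b ≤ 1 := (O.valuation_le_one_iff b).mpr hbO
  have h2 : ¬ O.valuation b < 1 := fun h => hb ((O.mem_nonunits_iff).mpr h)
  have h3 : O.valuation b = 1 := le_antisymm h1 (not_lt.mp h2)
  apply O.mem_of_valuation_le_one
  rw [map_inv₀, h3, inv_one]

/-- The centre `{x ∈ A | x ∈ 𝔪_O}` of `O` on a ring `A → O` is a prime ideal. [folklore] -/
theorem wildSymbol_centre_isPrime (O : ValuationSubring K) {A : Type} [CommRing A] [Algebra A K]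
    (hAO : ∀ a : A, algebraMap A K a ∈ O)
    (𝔮 : Ideal A) (h𝔮 : ∀ x : A, x ∈ 𝔮 ↔ algebraMap A K x ∈ O.nonunits) : 𝔮.IsPrime := by
  rw [Ideal.isPrime_iff]
  refine ⟨?_, ?_⟩
  · intro htop
    have h1 : (1 : A) ∈ 𝔮 := by rw [htop]; trivial
    have := (h𝔮 1).mp h1
    rw [map_one, O.mem_nonunits_iff, map_one] at this
    exact lt_irrefl _ this
  · intro x y hxy
    rw [h𝔮, h𝔮]
    rw [h𝔮, map_mul, O.mem_nonunits_iff, map_mul] at hxy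
    by_contra hcon
    push Not at hcon
    obtain ⟨hx, hy⟩ := hcon
    rw [O.mem_nonunits_iff, not_lt] at hx hy
    have hx1 : O.valuation (algebraMap A K x) = 1 :=
      le_antisymm ((O.valuation_le_one_iff _).mpr (hAO x)) hx
    have hy1 : O.valuation (algebraMap A K y) = 1 :=
      le_antisymm ((O.valuation_le_one_iff _).mpr (hAO y)) hy
    rw [hx1, hy1, mul_one] at hxy
    exact lt_irrefl _ hxy

/-- The local ring `A_𝔮 ⊆ K` at a prime `𝔮`, as an explicit subring of `K` (existence form, to keep
the file usable without new definitions downstream). [folklore] -/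
theorem wildSymbol_exists_locSubring {A : Type} [CommRing A] [Algebra A K] (𝔮 : Ideal A) [𝔮.IsPrime] :
    ∃ S : Subring K, ∀ x : K, x ∈ S ↔
      ∃ r s : A, s ∉ 𝔮 ∧ x * algebraMap A K s = algebraMap A K r := by
  have h1 : (1 : A) ∉ 𝔮 := fun h => Ideal.IsPrime.ne_top ‹_› ((Ideal.eq_top_iff_one _).mpr h)
  refine ⟨{ carrier := {x | ∃ r s : A, s ∉ 𝔮 ∧ x * algebraMap A K s = algebraMap A K r}
            mul_mem' := ?_, one_mem' := ⟨1, 1, h1, by simp⟩, add_mem' := ?_,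
            zero_mem' := ⟨0, 1, h1, by simp⟩, neg_mem' := ?_ }, fun x => Iff.rfl⟩
  · rintro x y ⟨r, s, hs, hx⟩ ⟨r', s', hs', hy⟩
    refine ⟨r * r', s * s', fun h => ((Ideal.IsPrime.mem_or_mem ‹_› h).elim hs hs'), ?_⟩
    simp only [map_mul]
    calc x * y * (algebraMap A K s * algebraMap A K s')
        = (x * algebraMap A K s) * (y * algebraMap A K s') := by ring
      _ = algebraMap A K r * algebraMap A K r' := by rw [hx, hy]
  · rintro x y ⟨r, s, hs, hx⟩ ⟨r', s', hs', hy⟩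
    refine ⟨r * s' + r' * s, s * s', fun h => ((Ideal.IsPrime.mem_or_mem ‹_› h).elim hs hs'), ?_⟩
    simp only [map_mul, map_add]
    calc (x + y) * (algebraMap A K s * algebraMap A K s')
        = (x * algebraMap A K s) * algebraMap A K s' + (y * algebraMap A K s') * algebraMap A K s := by
          ring
      _ = algebraMap A K r * algebraMap A K s' + algebraMap A K r' * algebraMap A K s := by rw [hx, hy]
  · rintro x ⟨r, s, hs, hx⟩
    exact ⟨-r, s, hs, by simp [neg_mul, hx]⟩

/-- **Krull–Akizuki, normal case (all in Mathlib).** For a Noetherian integrally closed domain `A`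
with fraction field `K` and a non-zero prime `𝔮` of height `≤ 1`, the explicit local ring
`S = A_𝔮 ⊆ K` is a discrete valuation ring of `K`: `S` is the localisation of `A` at `𝔮`
(`IsLocalization.AtPrime`), hence Noetherian, local, integrally closed, of Krull dimension
`ht 𝔮 ≤ 1` (`IsLocalization.AtPrime.ringKrullDim_eq_height`) and not a field, so Dedekind local,
so a DVR (`IsDiscreteValuationRing.TFAE`); a valuation ring of its fraction field `K` contains `x`
or `x⁻¹`. [folklore] -/
theorem wildSymbol_locSubring_dvr {A : Type} [CommRing A] [IsDomain A] [Algebra A K] [IsFractionRing A K]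
    [IsNoetherianRing A] [IsIntegrallyClosed A] (𝔮 : Ideal A) [𝔮.IsPrime] (h𝔮 : 𝔮 ≠ ⊥)
    (hht : 𝔮.height ≤ 1) (S : Subring K)
    (hS : ∀ x : K, x ∈ S ↔ ∃ r s : A, s ∉ 𝔮 ∧ x * algebraMap A K s = algebraMap A K r) :
    IsDiscreteValuationRing S ∧ ∀ x : K, x ∈ S ∨ x⁻¹ ∈ S := by
  have hinj : Function.Injective (algebraMap A K) := IsFractionRing.injective A K
  have h1 : (1 : A) ∉ 𝔮 := fun h => Ideal.IsPrime.ne_top ‹_› ((Ideal.eq_top_iff_one _).mpr h)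
  have hAS : ∀ r : A, algebraMap A K r ∈ S := fun r => (hS _).mpr ⟨r, 1, h1, by simp⟩
  let φ : A →+* S := (algebraMap A K).codRestrict S hAS
  letI : Algebra A S := φ.toAlgebra
  have hφ : ∀ r : A, ((algebraMap A S r : S) : K) = algebraMap A K r := fun r => rfl
  -- `S` is the localization of `A` at `𝔮`
  haveI hloc : IsLocalization.AtPrime S 𝔮 := by
    refine (isLocalization_iff _ _).mpr ⟨?_, ?_, ?_⟩
    · rintro ⟨y, hy⟩
      have hy0 : algebraMap A K y ≠ 0 := by
        intro h
        apply hy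
        rw [show y = 0 from hinj (by rw [h, map_zero])]
        exact 𝔮.zero_mem
      have hyinv : (algebraMap A K y)⁻¹ ∈ S :=
        (hS _).mpr ⟨1, y, hy, by rw [inv_mul_cancel₀ hy0, map_one]⟩
      refine IsUnit.of_mul_eq_one ⟨_, hyinv⟩ ?_
      apply Subtype.ext
      show algebraMap A K y * (algebraMap A K y)⁻¹ = 1
      exact mul_inv_cancel₀ hy0
    · rintro ⟨z, hz⟩
      obtain ⟨r, s, hs, h⟩ := (hS z).mp hz
      refine ⟨(r, ⟨s, hs⟩), ?_⟩
      apply Subtype.ext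
      exact h
    · intro r r' h
      refine ⟨1, ?_⟩
      have : algebraMap A K r = algebraMap A K r' := by
        have := congrArg (fun t : S => (t : K)) h
        simpa [hφ] using this
      rw [hinj this]
  haveI : IsLocalRing S := IsLocalization.AtPrime.isLocalRing S 𝔮
  haveI : IsNoetherianRing S := IsLocalization.isNoetherianRing 𝔮.primeCompl S inferInstance
  haveI : IsIntegrallyClosed S :=
    isIntegrallyClosed_of_isLocalization S 𝔮.primeCompl (Ideal.primeCompl_le_nonZeroDivisors 𝔮)
  have hdim : ringKrullDim S ≤ 1 := by
    rw [IsLocalization.AtPrime.ringKrullDim_eq_height 𝔮 S]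
    exact_mod_cast hht
  haveI : Ring.KrullDimLE 1 S := (Ring.krullDimLE_iff).mpr hdim
  haveI : Ring.DimensionLEOne S := ⟨fun hp hprime => hprime.isMaximal_of_ne_bot hp⟩
  haveI : IsDedekindRing S := {}
  -- not a field: a non-zero element of `𝔮` is a non-unit of `S`
  have hnf : ¬ IsField S := by
    intro hF
    obtain ⟨q, hq𝔮, hq0⟩ := Submodule.exists_mem_ne_zero_of_ne_bot h𝔮
    have hmax : algebraMap A S q ∈ IsLocalRing.maximalIdeal S :=
      (IsLocalization.AtPrime.to_map_mem_maximal_iff S 𝔮 q).mpr hq𝔮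
    have hq0' : algebraMap A S q ≠ 0 := by
      intro h
      apply hq0
      apply hinj
      rw [map_zero, ← hφ, h]
      rfl
    obtain ⟨t, ht⟩ := hF.mul_inv_cancel hq0'
    exact (IsLocalRing.maximalIdeal.isMaximal S).ne_top
      (Ideal.eq_top_of_isUnit_mem _ hmax (IsUnit.of_mul_eq_one t ht))
  have hDD : IsDedekindDomain S := inferInstance
  have hdvr : IsDiscreteValuationRing S :=
    ((IsDiscreteValuationRing.TFAE S hnf).out 0 2).mpr hDD
  refine ⟨hdvr, fun x => ?_⟩
  -- every element of `K` is in `S` or has its inverse in `S`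
  obtain ⟨a, b, hb, rfl⟩ := IsFractionRing.div_surjective (A := A) x
  have hb0 : algebraMap A K b ≠ 0 :=
    fun h => nonZeroDivisors.ne_zero hb (hinj (by rw [h, map_zero]))
  obtain ⟨c, hc⟩ := ValuationRing.cond (algebraMap A S a) (algebraMap A S b)
  rcases hc with hc | hc
  · right
    have hcK : algebraMap A K a * (c : K) = algebraMap A K b := by
      have := congrArg (fun t : S => (t : K)) hc
      simpa [hφ] using this
    have ha0 : algebraMap A K a ≠ 0 := by
      intro h
      rw [h, zero_mul] at hcK
      exact hb0 hcK.symm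
    have : (algebraMap A K a / algebraMap A K b)⁻¹ = (c : K) := by
      rw [inv_div, ← hcK]; field_simp
    rw [this]; exact c.2
  · left
    have hcK : algebraMap A K b * (c : K) = algebraMap A K a := by
      have := congrArg (fun t : S => (t : K)) hc
      simpa [hφ] using this
    have : algebraMap A K a / algebraMap A K b = (c : K) := by
      rw [← hcK]; field_simp
    rw [this]; exact c.2

/-- **No witness with a height-`≤ 1` centre on a normal affine model** (the crux plus
`IsIntegrallyClosedIn R K` plus "`ht (𝔪_O ∩ R) ≤ 1`" is FALSE). [folklore] -/
theorem not_wildSymbol_of_centre_height_le_one :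
    ¬ ∃ p : ℕ, p.Prime ∧ ∃ (k K : Type) (_ : Field k) (_ : CharP k p) (_ : PerfectField k) (_ : Field K) (_ : Algebra k K), (⊤ : IntermediateField k K).FG ∧ ∃ O : ValuationSubring K, (∀ c : k, algebraMap k K c ∈ O) ∧ ∃ R : Subalgebra k K, R.FG ∧ R.toSubring ≤ O.toSubring ∧ IsFractionRing R K ∧ IsIntegrallyClosedIn R K ∧ (∃ 𝔮 : Ideal R, (∀ x : R, x ∈ 𝔮 ↔ (x : K) ∈ O.nonunits) ∧ 𝔮.height ≤ 1) ∧ (let G := FreeAbelianGroup (K × Kˣ × Kˣ); let N : AddSubgroup G := AddSubgroup.closure { x | (∃ (a a' : K) (b c : Kˣ), x = .of (a + a', b, c) - .of (a, b, c) - .of (a', b, c)) ∨ (∃ (a : K) (b b' c : Kˣ), x = .of (a, b * b', c) - .of (a, b, c) - .of (a, b', c)) ∨ (∃ (a : K) (b c c' : Kˣ), x = .of (a, b, c * c') - .of (a, b, c) - .of (a, b, c')) ∨ (∃ (a : K) (b : Kˣ), x = .of (a, b, b)) ∨ (∃ (b c : Kˣ), x = .of ((b : K), b, c)) ∨ (∃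 (b c : Kˣ), x = .of ((c : K), b, c)) ∨ (∃ (a : K) (b c : Kˣ), x = .of (a ^ p - a, b, c)) }; let Unr : Subring K → AddSubgroup (G ⧸ N) := fun T => AddSubgroup.closure { y | ∃ (a : K) (b c : Kˣ), a ∈ T ∧ (b : K) ∈ T ∧ ((b⁻¹ : Kˣ) : K) ∈ T ∧ (c : K) ∈ T ∧ ((c⁻¹ : Kˣ) : K) ∈ T ∧ y = ((FreeAbelianGroup.of (a, b, c) : G) : G ⧸ N) }; ∃ α : G ⧸ N, (∀ W : ValuationSubring K, (∀ c : k, algebraMap k K c ∈ W) → IsDiscreteValuationRing W → (∃ B : Subalgebra k K, B.FG ∧ B.toSubring ≤ W.toSubring ∧ ∀ x : K, x ∈ W → ∃ b s : K, b ∈ B ∧ s ∈ B ∧ s ∉ W.nonunits ∧ x * s = b) → R.toSubring ≤ W.toSubring → (∀ x : K, x ∈ R → x ∈ W.nonunits → x ∈ O.nonunits) → α ∈ Unr W.toSubring) ∧ α ∉ Unr O.toSubring) := by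
  rintro ⟨p, -, k, K, _, _, _, _, _, -, O, hO, R, hR, hRO, hfr, hic, ⟨𝔮, h𝔮, hht⟩, α, hdiv, hα⟩
  haveI : Algebra.FiniteType k R := R.fg_iff_finiteType.mp hR
  haveI : IsNoetherianRing R := Algebra.FiniteType.isNoetherianRing k R
  haveI : IsFractionRing R K := hfr
  haveI : IsIntegrallyClosed R := (isIntegrallyClosed_iff_isIntegrallyClosedIn K).mpr hic
  have hRO' : ∀ a : R, algebraMap R K a ∈ O := fun a => hRO a.2
  haveI h𝔮p : 𝔮.IsPrime := wildSymbol_centre_isPrime O hRO' 𝔮 h𝔮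
  have hOtop : O ≠ ⊤ := by
    rintro rfl
    exact hα (by rw [wildSymbol_unr_top p K]; trivial)
  -- the centre is non-zero, for otherwise `K = Frac R ⊆ O`
  have h𝔮0 : 𝔮 ≠ ⊥ := by
    intro h
    apply hOtop
    ext x
    simp only [ValuationSubring.mem_top, iff_true]
    obtain ⟨a, b, hb, rfl⟩ := IsFractionRing.div_surjective (A := R) x
    have hb𝔮 : b ∉ 𝔮 := by
      rw [h, Ideal.mem_bot]
      exact nonZeroDivisors.ne_zero hb
    have hbinv : (algebraMap R K b)⁻¹ ∈ O :=
      wildSymbol_inv_mem_of_not_mem_nonunits O (hRO' b) (fun hh => hb𝔮 ((h𝔮 b).mpr hh))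
    rw [div_eq_mul_inv]
    exact O.mul_mem _ _ (hRO' a) hbinv
  -- `S = R_𝔮 ⊆ K` is a DVR of `K`, dominated by `O`
  obtain ⟨S, hS⟩ := wildSymbol_exists_locSubring (A := R) (K := K) 𝔮
  obtain ⟨hdvr, hval⟩ := wildSymbol_locSubring_dvr 𝔮 h𝔮0 hht S hS
  let V : ValuationSubring K := ⟨S, hval⟩
  have hSO : ∀ x : K, x ∈ S → x ∈ O := by
    intro x hx
    obtain ⟨r, s, hs, h⟩ := (hS x).mp hx
    have hsinv : (algebraMap R K s)⁻¹ ∈ O :=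
      wildSymbol_inv_mem_of_not_mem_nonunits O (hRO' s) (fun hh => hs ((h𝔮 s).mpr hh))
    have hsK : algebraMap R K s ≠ 0 := by
      intro h0
      apply hs
      have : s = 0 := IsFractionRing.injective R K (by rw [h0, map_zero])
      rw [this]; exact 𝔮.zero_mem
    have hx' : x = algebraMap R K r * (algebraMap R K s)⁻¹ := by
      rw [← h, mul_assoc, mul_inv_cancel₀ hsK, mul_one]
    rw [hx']
    exact O.mul_mem _ _ (hRO' r) hsinv
  have hVO : V ≤ O := fun x hx => hSO x hx
  haveI : IsDiscreteValuationRing V := hdvr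
  rcases ValuationSubring.eq_self_or_eq_top_of_le hVO with hVO' | htop
  · apply hα
    refine hdiv O hO ?_ ?_ hRO (fun x _ hx => hx)
    · rw [← hVO']; infer_instance
    · refine ⟨R, hR, hRO, fun x hx => ?_⟩
      have hxS : x ∈ S := by rw [← hVO'] at hx; exact hx
      obtain ⟨r, s, hs, h⟩ := (hS x).mp hxS
      exact ⟨r, s, r.2, s.2, fun hh => hs ((h𝔮 s).mpr hh), h⟩
  · exact hOtop htop

end Summit.ResolutionOfSingularities.ResolutionOfSingularities.Theorems.WildSymbol.Negative

end
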